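import Summits.QuantumFields.YangMills.Theorems.BalabanLadderUVSeamRecGaussianCalibrationKernel
import Summits.QuantumFields.YangMills.Theorems.BalabanLadderUVSeamRecGaussianCalibrationEnergy
import Literature.Probability.LatticeModels.DiscreteGFFDirichletField
import HarnessLib

/-!
# Crux `UVSeamRec` (stmt-QuantumFields-20043), free-field calibration of (RM), file 3b: harmonic extension into a cube, the geometry of
# `2R+4`-separated cube families in `ℤ⁴`, and flux pairings as linear statistics

Helper file (`--supports stmt-QuantumFields-20043`) of the seam seat `ym-20043-seam-s2` (gen 3); theorems only, no definitions.  Deterministic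
plumbing for the separated-family operator bound (`…GaussianCalibrationOperatorBound`) of the free-field calibration of the registered v5(α) stub
`BirthV5A.stub_responseMomentsOdd6 : UV → (RM)`:
* §1 the harmonic extension `φ − dirichletField Λ φ` of the exterior field into a finite `Λ` is lattice-harmonic on `Λ` (it is `φ` minus the Dirichlet
  Green potential of `−Δφ`), and on `Λ` it is the boundary linear statistic `Σ_{w} H_Λ(y,w) φ_w` (Poisson kernel, vanishing off `∂Λ`);
* §2 cubes `x + sbox ρ` as finsets: membership, outer boundary `⊆ x + sbox (ρ+1)`; for centres pairwise `2R+4`-separated in some coordinate, a point of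
  the outer boundary of one cube `x_{i'} + sbox (R+1)` lies in NO cube of the family, and the interior fluxes `avgKernel r (· − x_i)` (`4r ≤ R+3`) have
  pairwise DISJOINT supports inside `x_i + sbox (R+2)`;
* §3 summation by parts `Σ_j Σ_w M_j(w)(φ_{w+e_j} − φ_w) = Σ_w (div M)(w) φ_w` and the translation of box sums onto a common carrier.

No sorry, standard axioms.  HONEST FRAMING: lattice bookkeeping for a CALIBRATION theorem about the free field; nothing of E0′, not a gap, not Clay.
Reference: Friedli–Velenik 2017, Ch. 8 (GFF: harmonic extension and Markov property).
-/

set_option autoImplicit false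

noncomputable section

open MeasureTheory Finset
open Literature.Probability.LatticeModels
open Literature.MathematicalPhysics.QuantumFieldTheory.LatticeForm (e)
open Summit.QuantumFields.YangMills.Theorems.WeakCouplingRates.HarmonicInterior

namespace Summit.QuantumFields.YangMills.Cruxes.UVSeamRec.GaussianCalibration

/-! ## §1 The harmonic extension `φ − dirichletField Λ φ` -/

section HarmExt

variable {d : ℕ}

/-- The finite-volume field is the Dirichlet Green potential of `−Δφ`: `ψ^Λ = G_Λ(−Δφ)`. [folklore] -/
theorem dirichletField_eq_dirichletSolution (hd : 0 < d) (Λ : Finset (Site d)) (φ : Site d → ℝ) :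
    dirichletField Λ φ = dirichletSolution Λ (fun y => -latticeLaplacianZd φ y) := by
  funext x
  rw [dirichletField_eq_sum_innovation hd, dirichletSolution_apply]
  exact Finset.sum_congr rfl fun y _ => by rw [neg_latticeLaplacianZd_eq_innovation]

/-- **The harmonic extension is harmonic**: `Δ(φ − ψ^Λ) = 0` on `Λ`. [cite: FriedliVelenik2017, Ch. 8 Prop. 8.7] -/
theorem latticeLaplacianZd_sub_dirichletField (hd : 0 < d) (Λ : Finset (Site d)) (φ : Site d → ℝ) {y : Site d} (hy : y ∈ Λ) :
    latticeLaplacianZd (fun w => φ w - dirichletField Λ φ w) y = 0 := by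
  have h := neg_latticeLaplacianZd_dirichletSolution hd Λ (fun y => -latticeLaplacianZd φ y) hy
  rw [← dirichletField_eq_dirichletSolution hd] at h
  have e1 : (fun w => φ w - dirichletField Λ φ w) = φ - dirichletField Λ φ := rfl
  rw [e1, latticeLaplacianZd_sub]
  linarith

/-- The Poisson kernel `H_Λ(y, ·)` vanishes off the outer boundary of `Λ`. [folklore] -/
theorem poissonKernel_eq_zero_of_not_mem_outerBoundary (Λ : Finset (Site d)) (y : Site d) {w : Site d}
    (hw : w ∉ outerBoundary (zdGraph d) Λ) : Literature.Probability.LatticeModels.poissonKernel Λ y w = 0 := by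
  unfold Literature.Probability.LatticeModels.poissonKernel
  split_ifs with hwΛ
  · rfl
  · refine Finset.sum_eq_zero fun w' hw' => dirichletGreen_of_not_mem_right Λ y fun hw'Λ => hw ?_
    rw [mem_outerBoundary_iff]
    exact ⟨hwΛ, w', hw'Λ, ((SimpleGraph.mem_neighborFinset _ _ _).1 hw')⟩

/-- **The harmonic extension as a linear statistic**: for `y ∈ Λ` and any finite `S ⊇ ∂Λ`,
`φ_y − ψ^Λ_y = Σ_{w ∈ S} H_Λ(y, w) φ_w`. [folklore] -/
theorem sub_dirichletField_eq_sum {Λ S : Finset (Site d)} (hS : outerBoundary (zdGraph d) Λ ⊆ S) (φ : Site d → ℝ)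
    {y : Site d} (hy : y ∈ Λ) : φ y - dirichletField Λ φ y = ∑ w ∈ S, Literature.Probability.LatticeModels.poissonKernel Λ y w * φ w := by
  rw [dirichletField_of_mem φ hy, sub_sub_cancel]
  exact Finset.sum_subset hS fun w _ hw => by rw [poissonKernel_eq_zero_of_not_mem_outerBoundary Λ y hw, zero_mul]

end HarmExt

/-! ## §2 Geometry of cubes and separated families in `ℤ⁴` -/

section Geometry

/-- `x + z` lies in the cube `x + sbox ρ` for `z ∈ sbox ρ`. [folklore] -/
theorem add_mem_image_sbox {ρ : ℕ} (x : Site 4) {z : Site 4} (hz : z ∈ sbox ρ) :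
    x + z ∈ (sbox ρ).image (fun w => x + w) :=
  Finset.mem_image.2 ⟨z, hz, rfl⟩

/-- Membership in a translated sup-box, coordinatewise. [folklore] -/
theorem mem_image_sbox_iff {ρ : ℕ} (x w : Site 4) : w ∈ (sbox ρ).image (fun z => x + z) ↔ ∀ k, |w k - x k| ≤ ρ := by
  constructor
  · rintro h k
    obtain ⟨z, hz, rfl⟩ := Finset.mem_image.1 h
    have := mem_sbox.1 hz k
    simpa using this
  · intro h
    refine Finset.mem_image.2 ⟨w - x, mem_sbox.2 fun k => by simpa using h k, by abel⟩

/-- `0 ∈ sbox ρ`. [folklore] -/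
theorem zero_mem_sbox (ρ : ℕ) : (0 : Site 4) ∈ sbox ρ := mem_sbox.2 fun k => by simp

/-- `e j ∈ sbox ρ` for `ρ ≥ 1`. [folklore] -/
theorem e_mem_sbox {ρ : ℕ} (hρ : 1 ≤ ρ) (j : Fin 4) : (e j : Site 4) ∈ sbox ρ :=
  mem_sbox.2 fun k => by
    by_cases hkj : k = j
    · subst hkj; rw [e_def]; simp; exact_mod_cast hρ
    · rw [e_def]; simp [hkj]

/-- The outer boundary of the cube `x + sbox ρ` lies in `x + sbox (ρ+1)`. [folklore] -/
theorem outerBoundary_image_sbox_subset (ρ : ℕ) (x : Site 4) :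
    outerBoundary (zdGraph 4) ((sbox ρ).image (fun z => x + z)) ⊆ (sbox (ρ + 1)).image (fun z => x + z) := by
  intro w hw
  obtain ⟨-, y, hy, hadj⟩ := mem_outerBoundary_iff.1 hw
  rw [mem_image_sbox_iff] at hy ⊢
  obtain ⟨i, h | h⟩ := (zdGraph_adj_iff w y).1 hadj <;> intro k <;> have := hy k
  · rw [h] at this
    by_cases hki : k = i
    · subst hki; simp at this ⊢; rw [abs_le] at this ⊢; omega
    · simp [hki] at this ⊢; exact this.trans (by linarith)
  · rw [h]
    by_cases hki : k = i
    · subst hki; simp at this ⊢; rw [abs_le] at this ⊢; omega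
    · simp [hki] at this ⊢; exact this.trans (by linarith)

/-- A point of the outer boundary of one cube of a `2R+4`-separated family lies in NO cube of the family. [folklore] -/
theorem not_mem_of_mem_outerBoundary {ι : Type*} {R : ℕ} {x : ι → Site 4}
    (hsep : ∀ i i' : ι, i ≠ i' → ∃ k : Fin 4, 2 * (R : ℤ) + 4 ≤ |x i k - x i' k|) (i i' : ι) {w : Site 4}
    (hw : w ∈ outerBoundary (zdGraph 4) ((sbox (R + 1)).image (fun z => x i' + z))) :
    w ∉ (sbox (R + 1)).image (fun z => x i + z) := by
  intro hwi
  by_cases hii : i = i'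
  · subst hii; exact (mem_outerBoundary_iff.1 hw).1 hwi
  · obtain ⟨k, hk⟩ := hsep i i' hii
    have h1 := (mem_image_sbox_iff _ _).1 (outerBoundary_image_sbox_subset (R + 1) (x i') hw) k
    have h2 := (mem_image_sbox_iff _ _).1 hwi k
    push_cast at h1 h2
    rw [abs_le] at h1 h2
    rcases le_abs.1 hk with h | h <;> omega

/-- **Disjointness of the interior fluxes**: if `avgKernel r (w − x_i) ≠ 0` and `avgKernel r (w − x_{i'}) ≠ 0` with `4r − 2 ≤ R + 1`, then
`i = i'` (the supports `x_i + sbox (4r−2)` of a `2R+4`-separated family are pairwise disjoint). [folklore] -/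
theorem eq_of_avgKernel_ne_zero {ι : Type*} {R r : ℕ} (hrR : 4 * r ≤ R + 3) {x : ι → Site 4}
    (hsep : ∀ i i' : ι, i ≠ i' → ∃ k : Fin 4, 2 * (R : ℤ) + 4 ≤ |x i k - x i' k|) {i i' : ι} {w : Site 4}
    (hi : avgKernel r (w - x i) ≠ 0) (hi' : avgKernel r (w - x i') ≠ 0) : i = i' := by
  by_contra hii
  obtain ⟨k, hk⟩ := hsep i i' hii
  have h1 : w - x i ∈ sbox (4 * r - 2) := by by_contra h; exact hi (avgKernel_eq_zero_of_not_mem h)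
  have h2 : w - x i' ∈ sbox (4 * r - 2) := by by_contra h; exact hi' (avgKernel_eq_zero_of_not_mem h)
  have h1k := mem_sbox.1 h1 k
  have h2k := mem_sbox.1 h2 k
  simp only [Pi.sub_apply] at h1k h2k
  have hr' : ((4 * r - 2 : ℕ) : ℤ) ≤ (R : ℤ) + 1 := by omega
  rw [abs_le] at h1k h2k
  rcases le_abs.1 hk with h | h <;> omega

/-- Support of a translated interior flux: `avgKernel r (w − x) ≠ 0 ⇒ w − x ∈ sbox (4r − 2)`, hence `w` and `w + e_j` lie in `x + sbox (R+2)`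
when `4r ≤ R + 3`. [folklore] -/
theorem mem_of_avgKernel_ne_zero {R r : ℕ} (hrR : 4 * r ≤ R + 3) (x : Site 4) {w : Site 4} (hw : avgKernel r (w - x) ≠ 0) (j : Fin 4) :
    w ∈ (sbox (R + 2)).image (fun z => x + z) ∧ w + e j ∈ (sbox (R + 2)).image (fun z => x + z) := by
  have h1 : w - x ∈ sbox (4 * r - 2) := by by_contra h; exact hw (avgKernel_eq_zero_of_not_mem h)
  have hr' : ((4 * r - 2 : ℕ) : ℤ) + 1 ≤ (R : ℤ) + 2 := by omega
  rw [mem_image_sbox_iff, mem_image_sbox_iff]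
  refine ⟨fun k => ?_, fun k => ?_⟩ <;> have hk := mem_sbox.1 h1 k <;> simp only [Pi.sub_apply] at hk
  · push_cast; omega
  · by_cases hkj : k = j
    · subst hkj; rw [add_e_apply_same]; rw [abs_le] at hk ⊢; push_cast; omega
    · rw [add_e_apply_ne w hkj]; push_cast; omega

end Geometry

/-! ## §3 Flux pairings as linear statistics; translating box sums -/

section Sums

/-- **Summation by parts**: the pairing of an edge field `M` with the lattice gradient of `φ` is the linear statistic of `φ` with coefficients
the divergence `(div M)(w) = Σ_j (M_j(w − e_j) − M_j(w))` (for `M` supported in `S` together with its forward endpoints). [folklore] -/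
theorem sum_flux_eq_linStat {d : ℕ} (S : Finset (Site d)) (M : Fin d → Site d → ℝ)
    (hM : ∀ j z, M j z ≠ 0 → z ∈ S ∧ z + Pi.single j 1 ∈ S) (φ : Site d → ℝ) :
    ∑ j, ∑ w ∈ S, M j w * (φ (w + Pi.single j 1) - φ w) =
      ∑ w ∈ S, (∑ j, (M j (w - Pi.single j 1) - M j w)) * φ w := by
  have hj : ∀ j : Fin d, ∑ w ∈ S, M j w * (φ (w + Pi.single j 1) - φ w) =
      ∑ w ∈ S, (M j (w - Pi.single j 1) - M j w) * φ w := by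
    intro j
    simp_rw [mul_sub, Finset.sum_sub_distrib, sub_mul, Finset.sum_sub_distrib]
    rw [sum_shift_mul_eq S (M j) φ (Pi.single j 1) (hM j)]
  simp_rw [hj, Finset.sum_mul]
  rw [Finset.sum_comm]

/-- **Translating a box sum onto the common carrier**: `Σ_{z ∈ sbox(4r)} avgKernel r z · g(x + z) = Σ_{w ∈ S} avgKernel r (w − x) · g(w)` whenever
`S ⊇ x + sbox (R+2)` and `4r ≤ R + 3` (the kernel lives on `sbox (4r − 2)`). [folklore] -/
theorem sum_sbox_avgKernel_eq_sum {R r : ℕ} (hrR : 4 * r ≤ R + 3) (x : Site 4) {S : Finset (Site 4)}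
    (hS : (sbox (R + 2)).image (fun z => x + z) ⊆ S) (g : Site 4 → ℝ) :
    ∑ z ∈ sbox (4 * r), avgKernel r z * g (x + z) = ∑ w ∈ S, avgKernel r (w - x) * g w := by
  classical
  set A : Finset (Site 4) := (sbox (4 * r)).image (fun z => x + z) with hA
  set F : Site 4 → ℝ := fun w => avgKernel r (w - x) * g w with hF
  have hsupp : ∀ w, F w ≠ 0 → w ∈ A ∧ w ∈ S := by
    intro w hw
    have hne : avgKernel r (w - x) ≠ 0 := fun h => hw (by simp [hF, h])
    have h1 : w - x ∈ sbox (4 * r - 2) := by by_contra h; exact hne (avgKernel_eq_zero_of_not_mem h)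
    refine ⟨Finset.mem_image.2 ⟨w - x, mem_sbox.2 fun k => ?_, by abel⟩, hS ((mem_of_avgKernel_ne_zero hrR x hne 0).1)⟩
    have := mem_sbox.1 h1 k; push_cast at this ⊢; omega
  have hL : ∑ z ∈ sbox (4 * r), avgKernel r z * g (x + z) = ∑ w ∈ A, F w := by
    rw [hA, Finset.sum_image fun a _ b _ h => add_left_cancel h]
    exact Finset.sum_congr rfl fun z _ => by simp [hF]
  have h1 : ∑ w ∈ A, F w = ∑ w ∈ A ∪ S, F w :=
    Finset.sum_subset Finset.subset_union_left fun w _ hw => by by_contra h; exact hw (hsupp w h).1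
  have h2 : ∑ w ∈ S, F w = ∑ w ∈ A ∪ S, F w :=
    Finset.sum_subset Finset.subset_union_right fun w _ hw => by by_contra h; exact hw (hsupp w h).2
  rw [hL, h1, ← h2]

end Sums

end Summit.QuantumFields.YangMills.Cruxes.UVSeamRec.GaussianCalibration

end
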